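import Literature.Probability.RandomPlanarGeometry.CritPercSLESwallowing
import Literature.Probability.RandomPlanarGeometry.SLEDerivRatioMoments
import HarnessLib

/-!
# The one-point estimate for the SLE_κ trace, `κ < 8`: `P[dist(z, γ) ≤ ε] ≤ C (ε / Im z)^a`

Topic `Probability/RandomPlanarGeometry`. For `0 < κ < 8`, every exponent `0 < a < 1 - κ/8`, every
`z ∈ ℍ` and `ε > 0`,

  `P[ dist(z, γ[0,∞)) ≤ ε ] ≤ C_{κ,a} (ε / Im z)^a`       (`measure_infDist_sleTrace_le`)

for the SLE_κ trace `γ` (under `HasSLETrace κ`, Rohde–Schramm's Thm 5.1, a root named fact of the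
prelude for `κ ≠ 8`), with `C` independent of `z` and `ε`. This is the probabilistic input of the
**upper bound `dim_H γ[0,∞) ≤ 1 + κ/8`** (Rohde–Schramm, *Basic properties of SLE*, Ann. of
Math. 161 (2005), Thm 8.1: `E[N(ε)] ≈ Σ_j P[Z(z_j) > ε⁻¹]`, and Cor 8.2), in the non-sharp form
"every exponent `a < 1 - κ/8`" which suffices for the dimension (the printed Thm 8.1 has the sharp
`ε^{1-κ/8}` up to logarithms, via the exact hypergeometric moments of Lemma 6.3).

Proof (pp. 903, 914): by eq. (6.2) (Koebe), `dist(z, γ[0,∞) ∪ ℝ) ≥ Z(z)⁻¹ Im z / 2` where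
`Z(z) = sup_{t<τ(z)} ψₜ(z)`; in the tree `Loewner.ball_subset_domain_of_ratio_le` gives the disc of
radius `Im z/(64π M)` inside every `Hₜ`, `t < τ(z)`, when `ψ ≤ M` on `[0, τ(z))`, and such a disc
misses the whole generating curve (`IsGeneratedByCurve.forall_notMem_ball_of_ball_subset_domain`,
the set version of the tree's `notMem_range_of_ball_subset_domain`). Hence
`{dist(z, γ) ≤ ε} ⊆ {S ≥ (Im z/(64π ε))^a}` up to a null set, where `S = supₙ Ψₙ ≥ ψₜ^a` is the
measurable majorant of `SLEDerivRatioMoments.lean` with `E[S] ≤ C` for all `z`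
(`lintegral_iSup_slePointRatioPow_le`, Lemma 6.3 for all `a < 1 - κ/8`), and Markov's inequality
finishes.

## References

* S. Rohde, O. Schramm, *Basic properties of SLE*, Ann. of Math. 161 (2005): Lemma 6.3 and
  eq. (6.2) (p. 903), Thm 8.1 and Cor 8.2 (p. 914).
* G. F. Lawler, *Conformally Invariant Processes in the Plane*, AMS (2005), §7.4, Thm. 7.9
  (`c' ε^{1-κ/8} ≤ P{Δ_x ≤ ε} ≤ c ε^{1-κ/8}` for `κ < 8`, the sharp two-sided form), Thm 3.17 (Koebe).
-/

noncomputable section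

open Set Filter MeasureTheory Metric Complex
open _root_.Topology
open UpperHalfPlane (upperHalfPlaneSet)
open scoped NNReal ENNReal Real

namespace Literature.Probability.RandomPlanarGeometry

namespace Loewner

variable {W : ℝ≥0 → ℝ} {γ : ℝ≥0 → ℂ}

/-- **A disc that stays inside `Hₜ` for all `t < T_z` misses the whole generating curve** (set
version of `IsGeneratedByCurve.notMem_range_of_ball_subset_domain`, same proof): before `T_z` the
curve avoids `Hₜ ⊇` disc; if `T_z < ∞` the disc — a connected subset of `ℍ ∖ γ[0, T_z]` through
`z ∉ H_{T_z}` — is disjoint from the unbounded component `H_{T_z}`, hence from its closure, which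
contains `γ[T_z, ∞)` (`IsGeneratedByCurve.mem_closure_domain`). This is "`lim_{t↑τ(z₀)} rₜ =
dist(z₀, γ[0,∞) ∪ ℝ)`" of Rohde–Schramm (2005), p. 903. [cite: RohdeSchramm2005, eq. (6.2)] -/
theorem IsGeneratedByCurve.forall_notMem_ball_of_ball_subset_domain (hγ : IsGeneratedByCurve W γ)
    (hW : Continuous W) {z : ℂ} (hz : 0 < z.im) {ρ : ℝ} (hρ : 0 < ρ)
    (hball : ∀ t : ℝ≥0, (t : WithTop ℝ≥0) < swallowingTime W z → ball z ρ ⊆ domain W t)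
    (s : ℝ≥0) : γ s ∉ ball z ρ := by
  intro hs
  -- before `T_z` the curve avoids the disc
  have hav : ∀ r : ℝ≥0, (r : WithTop ℝ≥0) < swallowingTime W z → γ r ∉ ball z ρ := by
    intro r hr hmem
    exact (hγ.domain_subset_diff r (hball r hr hmem)).2 ⟨r, ⟨zero_le, le_rfl⟩, rfl⟩
  -- so `T_z ≤ s`
  have hτs : swallowingTime W z ≤ s := le_of_not_gt fun h ↦ hav s h hs
  obtain ⟨τ₀, hτ₀⟩ : ∃ τ₀ : ℝ≥0, swallowingTime W z = τ₀ :=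
    Option.ne_none_iff_exists'.1 (ne_top_of_le_ne_top WithTop.coe_ne_top hτs)
  have hτ₀s : τ₀ ≤ s := by rw [hτ₀] at hτs; exact_mod_cast hτs
  have hzW : z ≠ W 0 := by
    intro h
    have : z.im = 0 := by rw [h, Complex.ofReal_im]
    exact hz.ne' this
  have hτ₀pos : 0 < τ₀ := by
    have h0 := swallowingTime_pos_holds hW hzW
    rw [hτ₀] at h0
    exact_mod_cast h0
  -- the curve avoids the disc on `[0, τ₀]` (at `τ₀` by continuity from the left)
  have hav' : ∀ r : ℝ≥0, r ≤ τ₀ → γ r ∉ ball z ρ := by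
    intro r hr
    rcases hr.lt_or_eq with hlt | rfl
    · exact hav r (by rw [hτ₀]; exact_mod_cast hlt)
    · have hmaps : MapsTo γ (Iio r) (ball z ρ)ᶜ := fun u hu ↦
        hav u (by rw [hτ₀]; exact_mod_cast hu)
      have hcl : r ∈ closure (Iio r) := by
        rw [closure_Iio' (show (Iio (r : ℝ≥0)).Nonempty from ⟨0, hτ₀pos⟩)]
        exact self_mem_Iic
      have := map_mem_closure hγ.continuous hcl hmaps
      rwa [isOpen_ball.isClosed_compl.closure_eq] at this
  -- the disc lies in `U = ℍ ∖ γ[0, τ₀]`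
  set U : Set ℂ := upperHalfPlaneSet \ γ '' Icc 0 τ₀ with hU_def
  have hU : ball z ρ ⊆ U := by
    intro p hp
    refine ⟨domain_subset W 0 (hball 0 (by rw [hτ₀]; exact_mod_cast hτ₀pos) hp), ?_⟩
    rintro ⟨r, hr, rfl⟩
    exact hav' r hr.2 hp
  -- the disc is disjoint from `H_{τ₀}` (else `z ∈ H_{τ₀}`, i.e. `τ₀ < T_z`)
  have hdisj : ∀ p ∈ ball z ρ, p ∉ domain W τ₀ := by
    intro p hp hpdom
    rw [hγ.domain_eq] at hpdom
    have hsub : ball z ρ ⊆ connectedComponentIn U z :=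
      (convex_ball z ρ).isPreconnected.subset_connectedComponentIn (mem_ball_self hρ) hU
    have heq : connectedComponentIn U z = connectedComponentIn U p :=
      connectedComponentIn_eq (hsub hp)
    have hzdom : z ∈ domain W τ₀ := by
      rw [hγ.domain_eq]
      exact ⟨hU (mem_ball_self hρ), heq ▸ hpdom.2⟩
    have := ((mem_domain_iff W τ₀ z).1 hzdom).2
    rw [hτ₀] at this
    exact lt_irrefl _ this
  -- but `γ s ∈ closure H_{τ₀}` lies in the open disc
  have hcl : γ s ∈ closure (domain W τ₀) := hγ.mem_closure_domain hW hτ₀s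
  rw [_root_.mem_closure_iff] at hcl
  obtain ⟨p, hp, hpdom⟩ := hcl (ball z ρ) isOpen_ball hs
  exact hdisj p hp hpdom

/-- **Eq. (6.2) for the whole trace**: if Rohde–Schramm's ratio `ψₜ(z) = (Im z)|gₜ'(z)|/Im gₜ(z)`
is at most `M` for all `t < T_z` (`z ∈ ℍ`), then `dist(z, γ[0,∞)) ≥ Im z / (64 π M)` for the
generating curve `γ` (Rohde–Schramm (2005), p. 903: "`Z(z₀)⁻¹ Im z₀ / 2 ≤ dist(z₀, γ[0,∞) ∪ ℝ)`",
with the tree's proved Koebe constant `1/(128π)` in place of `1/4`).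
[cite: RohdeSchramm2005, eq. (6.2)] -/
theorem IsGeneratedByCurve.le_infDist_range_of_derivRatio_le (hγ : IsGeneratedByCurve W γ)
    (hW : Continuous W) {z : ℂ} (hz : 0 < z.im) {M : ℝ}
    (hM : ∀ t : ℝ≥0, (t : WithTop ℝ≥0) < swallowingTime W z → derivRatio W z t ≤ M) :
    z.im / (64 * π * M) ≤ infDist z (range γ) := by
  have hzW : z ≠ W 0 := by
    intro h
    have : z.im = 0 := by rw [h, Complex.ofReal_im]
    exact hz.ne' this
  have h0 : ((0 : ℝ≥0) : WithTop ℝ≥0) < swallowingTime W z := swallowingTime_pos_holds hW hzW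
  have hM1 : 1 ≤ M := (one_le_derivRatio hW hz h0).trans (hM 0 h0)
  have hρ : 0 < z.im / (64 * π * M) := by positivity
  have hball : ∀ t : ℝ≥0, (t : WithTop ℝ≥0) < swallowingTime W z →
      ball z (z.im / (64 * π * M)) ⊆ domain W t := fun t ht ↦
    ball_subset_domain_of_ratio_le hW hz ht (hM t ht)
  rw [le_infDist (range_nonempty γ)]
  rintro _ ⟨s, rfl⟩
  have h := hγ.forall_notMem_ball_of_ball_subset_domain hW hz hρ hball s
  rw [mem_ball, not_lt, dist_comm] at h
  exact h

end Loewner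

open Loewner Literature.Probability.Process

variable {κ : ℝ≥0}

/-- **The event `{dist(z, γ) ≤ ε}` forces a large majorant `S`**: on the event that the chain of
`√κ B(ω)` is generated by a curve, if `dist(z, γ[0,∞)) ≤ ε` (`z ∈ ℍ`, `ε > 0`, `a > 0`) then
`S(ω) = supₙ Ψₙ(ω) ≥ ((Im z)/(64 π ε))^a` — otherwise `ψₜ ≤ S^{1/a} < Im z/(64πε)` on `[0, τ(z))`
and (6.2) would give `dist(z, γ) > ε`. [cite: RohdeSchramm2005, eq. (6.2) and Thm 8.1 (proof)] -/
theorem ofReal_rpow_le_iSup_of_infDist_sleTrace_le {z : ℂ} (hz : 0 < z.im) {a : ℝ} (ha : 0 < a) {ε : ℝ}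
    (hε : 0 < ε) {ω : ℝ≥0 → ℝ} (hgen : ∃ γ, IsGeneratedByCurve (sleDriving κ ω) γ)
    (hdist : infDist z (range (sleTrace κ ω)) ≤ ε) :
    ENNReal.ofReal ((z.im / (64 * π * ε)) ^ a) ≤ ⨆ n, slePointRatioPowSeq κ z a n ω := by
  set S : ℝ≥0∞ := ⨆ n, slePointRatioPowSeq κ z a n ω with hS
  by_contra hlt
  push Not at hlt
  have hStop : S ≠ ∞ := ne_top_of_lt hlt
  -- `ψₜ ≤ M := S.toReal^{1/a}` for all `t < τ(z)`
  set M : ℝ := S.toReal ^ (1 / a) with hM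
  have hψ : ∀ t : ℝ≥0, (t : WithTop ℝ≥0) < swallowingTime (sleDriving κ ω) z →
      derivRatio (sleDriving κ ω) z t ≤ M := by
    intro t ht
    have h1 := ofReal_derivRatio_rpow_le_iSup hz ha.le ω ht (κ := κ)
    rw [← hS] at h1
    have hψ0 : 0 ≤ derivRatio (sleDriving κ ω) z t :=
      zero_le_one.trans (one_le_derivRatio (continuous_sleDriving κ ω) hz ht)
    have h2 : derivRatio (sleDriving κ ω) z t ^ a ≤ S.toReal :=
      (ENNReal.ofReal_le_iff_le_toReal hStop).1 h1
    have h3 := Real.rpow_le_rpow (Real.rpow_nonneg hψ0 a) h2 (one_div_nonneg.2 ha.le)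
    rwa [← Real.rpow_mul hψ0, mul_one_div_cancel ha.ne', Real.rpow_one] at h3
  -- hence `dist(z, γ) ≥ Im z / (64 π M)`, and `M < Im z / (64 π ε)` gives `dist > ε`
  have hgen' := isGeneratedByCurve_trace hgen
  have hle := hgen'.le_infDist_range_of_derivRatio_le (continuous_sleDriving κ ω) hz hψ
  have hzW : z ≠ sleDriving κ ω 0 := ne_driving_of_im_pos hz 0
  have h0 : ((0 : ℝ≥0) : WithTop ℝ≥0) < swallowingTime (sleDriving κ ω) z :=
    swallowingTime_pos_holds (continuous_sleDriving κ ω) hzW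
  have hM1 : 1 ≤ M := (one_le_derivRatio (continuous_sleDriving κ ω) hz h0).trans (hψ 0 h0)
  have hM0 : 0 < M := one_pos.trans_le hM1
  -- `M^a = S.toReal < (Im z/(64πε))^a`, so `M < Im z/(64πε)`
  have hMa : M ^ a = S.toReal := by
    rw [hM, ← Real.rpow_mul ENNReal.toReal_nonneg, one_div_mul_cancel ha.ne', Real.rpow_one]
  have hq0 : 0 < z.im / (64 * π * ε) := by positivity
  have hlt' : S.toReal < (z.im / (64 * π * ε)) ^ a := by
    have := (ENNReal.lt_ofReal_iff_toReal_lt hStop).1 hlt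
    exact this
  have hMlt : M < z.im / (64 * π * ε) := by
    rw [← hMa] at hlt'
    exact (Real.rpow_lt_rpow_iff hM0.le hq0.le ha).1 hlt'
  -- compare the two distances
  have hεlt : ε < z.im / (64 * π * M) := by
    rw [lt_div_iff₀ (by positivity)] at hMlt ⊢
    nlinarith [Real.pi_pos]
  have : infDist z (range (sleTrace κ ω)) > ε := lt_of_lt_of_le hεlt hle
  linarith

/-- **The one-point estimate for the SLE_κ trace** (`0 < κ < 8`, `0 < a < 1 - κ/8`, under
`HasSLETrace κ`): there is `C` such that for all `z ∈ ℍ` and `ε > 0`,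
`P[dist(z, γ[0,∞)) ≤ ε] ≤ C (ε / Im z)^a` — the events `{dist(z_j, γ) < ε}` counted in
Rohde–Schramm's proof of Thm 8.1 (`E[N] ≍ Σ_j P[Z(z_j) > ε⁻¹]`, p. 914), estimated through
Lemma 6.3 (all moments `a < 1 - κ/8`, `lintegral_iSup_slePointRatioPow_le`), eq. (6.2)
(`ofReal_rpow_le_iSup_of_infDist_sleTrace_le`) and Markov's inequality. The measure of the
(possibly non-measurable) event is its outer measure. [cite: RohdeSchramm2005, Thm 8.1] -/
theorem measure_infDist_sleTrace_le (hκ0 : 0 < κ) {a : ℝ} (ha : 0 < a) (ha8 : a < 1 - (κ : ℝ) / 8)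
    (hT : HasSLETrace κ) :
    ∃ C : ℝ≥0, ∀ {z : ℂ}, 0 < z.im → ∀ {ε : ℝ}, 0 < ε →
      preWienerMeasure {ω | infDist z (range (sleTrace κ ω)) ≤ ε} ≤
        C * ENNReal.ofReal ((ε / z.im) ^ a) := by
  obtain ⟨C, hC⟩ := lintegral_iSup_slePointRatioPow_le hκ0 ha.le ha8
  set K : ℝ≥0 := ((64 * π) ^ a).toNNReal with hK
  refine ⟨C * K, fun {z} hz {ε} hε ↦ ?_⟩
  set A : Set (ℝ≥0 → ℝ) := {ω | infDist z (range (sleTrace κ ω)) ≤ ε} with hA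
  set Good : Set (ℝ≥0 → ℝ) := {ω | ∃ γ, IsGeneratedByCurve (sleDriving κ ω) γ} with hGood
  set L : ℝ≥0∞ := ENNReal.ofReal ((z.im / (64 * π * ε)) ^ a) with hL
  set S : (ℝ≥0 → ℝ) → ℝ≥0∞ := fun ω ↦ ⨆ n, slePointRatioPowSeq κ z a n ω with hS
  have hGc : preWienerMeasure Goodᶜ = 0 := by
    have h : ∀ᵐ ω ∂preWienerMeasure, ω ∈ Good := hT
    exact mem_ae_iff.1 (Filter.eventually_iff.1 h)
  -- `A ⊆ {S ≥ L} ∪ Goodᶜ`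
  have hsub : A ⊆ {ω | L ≤ S ω} ∪ Goodᶜ := by
    intro ω hω
    by_cases hg : ω ∈ Good
    · exact Or.inl (ofReal_rpow_le_iSup_of_infDist_sleTrace_le hz ha hε hg hω)
    · exact Or.inr hg
  have hq0 : 0 < z.im / (64 * π * ε) := by positivity
  have hL0 : L ≠ 0 := by
    rw [hL]
    exact (ENNReal.ofReal_pos.2 (Real.rpow_pos_of_pos hq0 a)).ne'
  have hLtop : L ≠ ∞ := ENNReal.ofReal_ne_top
  -- Markov
  have hmarkov : preWienerMeasure {ω | L ≤ S ω} ≤ C / L := by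
    calc preWienerMeasure {ω | L ≤ S ω} ≤ (∫⁻ ω, S ω ∂preWienerMeasure) / L :=
          meas_ge_le_lintegral_div (measurable_iSup_slePointRatioPowSeq κ hz a).aemeasurable hL0 hLtop
      _ ≤ C / L := ENNReal.div_le_div_right (hC hz) L
  -- `C / L = C (64π)^a (ε/Im z)^a`
  have hCL : (C : ℝ≥0∞) / L = ((C * K : ℝ≥0) : ℝ≥0∞) * ENNReal.ofReal ((ε / z.im) ^ a) := by
    have h64 : (0 : ℝ) ≤ 64 * π := by positivity
    have hinv : ((z.im / (64 * π * ε)) ^ a)⁻¹ = (64 * π) ^ a * (ε / z.im) ^ a := by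
      rw [← Real.inv_rpow hq0.le, ← Real.mul_rpow h64 (div_nonneg hε.le hz.le)]
      congr 1
      field_simp
    have hKe : (K : ℝ≥0∞) = ENNReal.ofReal ((64 * π) ^ a) := by rw [hK]; rfl
    rw [hL, div_eq_mul_inv, ← ENNReal.ofReal_inv_of_pos (Real.rpow_pos_of_pos hq0 a), hinv,
      ENNReal.ofReal_mul (Real.rpow_nonneg h64 a), ENNReal.coe_mul, hKe, mul_assoc]
  calc preWienerMeasure A ≤ preWienerMeasure ({ω | L ≤ S ω} ∪ Goodᶜ) := measure_mono hsub
    _ ≤ preWienerMeasure {ω | L ≤ S ω} + preWienerMeasure Goodᶜ := measure_union_le _ _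
    _ = preWienerMeasure {ω | L ≤ S ω} := by rw [hGc, add_zero]
    _ ≤ C / L := hmarkov
    _ = _ := hCL

end Literature.Probability.RandomPlanarGeometry
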